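import Literature.NumberTheory.GelbartRogawski1991.DoubledWeilRepresentationArchLagrangian
import Literature.NumberTheory.GelbartRogawski1991.DoubledUnitarySiegelParabolicAlgebra
import Literature.NumberTheory.GelbartRogawski1991.DoubledWeilRepresentationRationalSchur
import HarnessLib

-- buildfix G11b-3 recipe (LEDGER B13-1/B13-3): elaborate sequentially so the trailing `attribute [implicit_reducible]`
-- block (reducibilityCoreExt is keyed to the async environment branch) is in force at `.olean` export.
set_option Elab.async false

/-!
# Rational clause of the doubled Weil representation, II: the Siegel decomposition and propagation

[GelbartRogawski1991, §3.1 Prop. 3.1.1 p. 455 L1–2] by doubling, second half of the rational clause: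
* **S3-dec** `S3dec_siegel_decomposition`: for a RATIONAL Siegel element `p ∈ P_Δ(L⁺)` there is
  `B ∈ Sp_{2(n+n)}(L⁺)` with `ratSp B = ι^𝔻 p` and `δ B δ⁻¹` in the submonoid generated by the rational Levi elements
  and the lower unipotents (`δ B δ⁻¹` preserves `𝕐 = δ(Res Δ)` — `deltaD_mulVec_diag`, `resSpD_mulVec_diag` — hence has
  zero upper-right block, `mem_closure_levi_low_of_toBlocks₁₂_eq_zero` from Mathlib's `SymplecticGroup`);
* matrix identities for `T^𝔻` and `δ` on Darboux-diagonal vectors (`gramD_mulVec_diag`, `deltaD_mulVec_diag`,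
  `exists_deltaD_mulVec_eq`; the re-enumeration bookkeeping `sumElim_comp_sumCongr_e₂_symm'`, `mulVec_comp_equiv_symm'`,
  `isUnit_det_gramR₀`, `coe_deltaD'` is imported from `DoubledWeilRepresentationArchLagrangian`) and a test function with `Φ(0) ≠ 0` (`exists_piSchwartzBruhat_apply_zero_ne_zero`);
* **S3** `S3_parabolic_rational`: a doubled Weil representation `sD` (`IsDoubledWeilRep χ sD`) takes values in
  `range r_F^𝔻` on `P_Δ(L⁺)` — `sD p` and `r_F^𝔻(B)` lie over the same `ι^𝔻 p` and have the same value-at-0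
  functional after `δ`-conjugation (`1`, by S3c and S3b-val of `DoubledWeilRepresentationRationalSchur`), so the
  pinning lemma applies;
* **S3′** `S3'_propagate`: agreement with `r_F^𝔻` on `P_Δ(L⁺)` propagates to its conjugate-closure, i.e. to all of
  `H(L⁺)` given S2 (central characters; abstract group theory `propagate_abstract`).
-/

set_option autoImplicit false

noncomputable section

open scoped Classical
open scoped Matrix Kronecker TensorProduct
open NumberField IsDedekindDomain
open Literature.RepresentationTheory.HeisenbergGroup
open Literature.NumberTheory.Automorphic
open Literature.NumberTheory.Weil1964
open Literature.RepresentationTheory.HarrisKudlaSweet1996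
open Literature.NumberTheory.GaloisRepresentations

namespace Literature.NumberTheory.GelbartRogawski1991.GRConstruction

open UnitaryDualPair

variable (L : Type) [Field L] [NumberField L] [IsCMField L]

variable {N M n : ℕ} (e : Fin N × Fin M ≃ Fin n)
  (dV : Fin N → L) (hdV : ∀ i, IsCMField.complexConj L (dV i) = dV i) (hdV0 : ∀ i, dV i ≠ 0)
  (dW : Fin M → L) (hdW : ∀ i, IsCMField.complexConj L (dW i) = dW i) (hdW0 : ∀ i, dW i ≠ 0)

/-! #### S3-dec: the rational Siegel decomposition `δ ι^𝔻(p) δ⁻¹ ∈ ⟨m(a), v(σ)⟩` for `p ∈ P_Δ(L⁺)` -/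

/-- GENERIC: a block-lower-triangular symplectic matrix is `v(c) m(a)` (`a = g₁₁`, `c = g₂₁ g₁₁⁻¹`), hence lies in the
submonoid generated by the Levi and lower-unipotent elements (the standard Siegel parabolic `P_𝕐`).
[cite: GelbartRogawski1991, §3.1 Prop. 3.1.1 p. 455 L1–2] -/
theorem mem_closure_levi_low_of_toBlocks₁₂_eq_zero {l R : Type*} [DecidableEq l] [Fintype l] [CommRing R]
    (g : Matrix.symplecticGroup l R) (h0 : (g : Matrix (l ⊕ l) (l ⊕ l) R).toBlocks₁₂ = 0) :
    g ∈ Submonoid.closure ((Set.range (SymplecticMatrix.levi (l := l) (R := R))) ∪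
      {x | ∃ σ hσ, x = SymplecticMatrix.low (l := l) (R := R) σ hσ}) := by
  set A := (g : Matrix (l ⊕ l) (l ⊕ l) R).toBlocks₁₁ with hA
  set C := (g : Matrix (l ⊕ l) (l ⊕ l) R).toBlocks₂₁ with hC
  set D := (g : Matrix (l ⊕ l) (l ⊕ l) R).toBlocks₂₂ with hD
  have hg : (g : Matrix (l ⊕ l) (l ⊕ l) R) = Matrix.fromBlocks A 0 C D := by
    rw [← h0]; exact (Matrix.fromBlocks_toBlocks _).symm
  obtain ⟨h1, -, h3⟩ := SymplecticGroup.fromBlocks_mem_iff.1 (hg ▸ g.2)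
  rw [Matrix.mul_zero, sub_zero] at h3
  have hDA : Dᵀ * A = 1 := by
    simpa only [Matrix.transpose_mul, Matrix.transpose_transpose, Matrix.transpose_one] using
      congrArg Matrix.transpose h3
  have hAD : A * Dᵀ = 1 := mul_eq_one_comm.1 hDA
  have hDAt : D * Aᵀ = 1 := by
    simpa only [Matrix.transpose_mul, Matrix.transpose_transpose, Matrix.transpose_one] using
      congrArg Matrix.transpose hAD
  obtain ⟨a, ha, hai⟩ : ∃ a : GL l R, (a : Matrix l l R) = A ∧ ((a⁻¹ : GL l R) : Matrix l l R) = Dᵀ :=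
    ⟨⟨A, Dᵀ, hAD, hDA⟩, rfl, rfl⟩
  set c : Matrix l l R := C * Dᵀ with hc_def
  have hCt : Cᵀ = Aᵀ * C * Dᵀ := by
    rw [h1, Matrix.mul_assoc, hAD, Matrix.mul_one]
  have hc : c.IsSymm := by
    change (C * Dᵀ)ᵀ = C * Dᵀ
    rw [Matrix.transpose_mul, Matrix.transpose_transpose, hCt, ← Matrix.mul_assoc, ← Matrix.mul_assoc, hDAt,
      Matrix.one_mul]
  have hfac : g = SymplecticMatrix.low c hc * SymplecticMatrix.levi a := by
    apply Subtype.ext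
    rw [Submonoid.coe_mul, SymplecticMatrix.coe_low, SymplecticMatrix.coe_levi, Matrix.fromBlocks_multiply, hg, ha, hai,
      Matrix.transpose_transpose]
    simp only [Matrix.one_mul, Matrix.zero_mul, Matrix.mul_zero, add_zero, zero_add]
    rw [hc_def, Matrix.mul_assoc, hDA, Matrix.mul_one]
  rw [hfac]
  exact Submonoid.mul_mem _ (Submonoid.subset_closure (Or.inr ⟨c, hc, rfl⟩))
    (Submonoid.subset_closure (Or.inl ⟨a, rfl⟩))

/-- GENERIC: a block matrix whose action preserves `𝕐 = {(0, y)}` has vanishing upper-right block.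
[cite: GelbartRogawski1991, §3.1 Prop. 3.1.1 p. 455 L1–2] -/
theorem toBlocks₁₂_eq_zero_of_mulVec {l R : Type*} [Fintype l] [DecidableEq l] [CommRing R]
    (A : Matrix (l ⊕ l) (l ⊕ l) R) (h : ∀ y : l → R, ∃ y' : l → R, A *ᵥ Sum.elim (0 : l → R) y = Sum.elim (0 : l → R) y') :
    A.toBlocks₁₂ = 0 := by
  have key : ∀ y : l → R, A.toBlocks₁₂ *ᵥ y = 0 := by
    intro y
    obtain ⟨y', hy'⟩ := h y
    have h2 : A *ᵥ Sum.elim (0 : l → R) y = Sum.elim (A.toBlocks₁₂ *ᵥ y) (A.toBlocks₂₂ *ᵥ y) := by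
      conv_lhs => rw [← Matrix.fromBlocks_toBlocks A]
      rw [Matrix.fromBlocks_mulVec, Sum.elim_comp_inl, Sum.elim_comp_inr, Matrix.mulVec_zero, Matrix.mulVec_zero,
        zero_add, zero_add]
    rw [h2] at hy'
    funext i
    simpa only [Sum.elim_inl, Pi.zero_apply] using congr_fun hy' (Sum.inl i)
  ext i j
  simpa only [Matrix.mulVec_single_one, Matrix.col_apply, Matrix.zero_apply, Pi.zero_apply] using
    congr_fun (key (Pi.single j 1)) i

/-- `T^𝔻 (z, z) = (T z, −T z)` in the block enumeration. [cite: GelbartRogawski1991, §3.1 Prop. 3.1.1 p. 455 L1–2] -/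
theorem gramD_mulVec_diag (z : Fin n → Fp L) :
    gramD L e dV hdV dW hdW *ᵥ (Sum.elim z z ∘ ⇑(e₂ (n := n)).symm) =
      Sum.elim (gramR L e dV hdV dW hdW *ᵥ z) (-(gramR L e dV hdV dW hdW *ᵥ z)) ∘ ⇑(e₂ (n := n)).symm := by
  have h1 : Matrix.reindex (e₂ (n := n)).symm (e₂ (n := n)).symm (gramD L e dV hdV dW hdW) =
      Matrix.fromBlocks (gramR L e dV hdV dW hdW) 0 0 (-gramR L e dV hdV dW hdW) := by
    rw [gramD]; exact (Matrix.reindex (e₂ (n := n)) (e₂ (n := n))).symm_apply_apply _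
  rw [mulVec_comp_equiv_symm', h1, Matrix.fromBlocks_mulVec, Sum.elim_comp_inl, Sum.elim_comp_inr, Matrix.zero_mulVec,
    Matrix.neg_mulVec, add_zero, zero_add]

/-- **`δ` maps the Darboux image of the diagonal `Δ` onto `𝕐`**: `δ (P (a,a; z,z)) = (0; (T z, −a))`
(`deltaDiagMatrix_mulVec_diag`, re-enumerated). [cite: GelbartRogawski1991, §3.1 Prop. 3.1.1 p. 455 L1–2] -/
theorem deltaD_mulVec_diag (a z : Fin n → Fp L) :
    ((deltaD L : Matrix.symplecticGroup (Fin (n + n)) (Fp L)) :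
        Matrix (Fin (n + n) ⊕ Fin (n + n)) (Fin (n + n) ⊕ Fin (n + n)) (Fp L)) *ᵥ
        Sum.elim (Sum.elim a a ∘ ⇑(e₂ (n := n)).symm) (gramD L e dV hdV dW hdW *ᵥ (Sum.elim z z ∘ ⇑(e₂ (n := n)).symm)) =
      Sum.elim (0 : Fin (n + n) → Fp L) (Sum.elim (gramR L e dV hdV dW hdW *ᵥ z) (-a) ∘ ⇑(e₂ (n := n)).symm) := by
  have h1 : Matrix.reindex ((e₂ (n := n)).sumCongr (e₂ (n := n))).symm ((e₂ (n := n)).sumCongr (e₂ (n := n))).symm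
      ((deltaD L : Matrix.symplecticGroup (Fin (n + n)) (Fp L)) :
        Matrix (Fin (n + n) ⊕ Fin (n + n)) (Fin (n + n) ⊕ Fin (n + n)) (Fp L)) = deltaDiagMatrix (Fp L) (Fin n) := by
    rw [coe_deltaD']; exact (Matrix.reindex _ _).symm_apply_apply _
  rw [gramD_mulVec_diag, ← sumElim_comp_sumCongr_e₂_symm', mulVec_comp_equiv_symm', h1, deltaDiagMatrix_mulVec_diag,
    sumElim_comp_sumCongr_e₂_symm']
  rfl

include hdV0 hdW0 in
/-- every `(0; y) ∈ 𝕐` is `δ` of a Darboux-diagonal vector.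
[cite: GelbartRogawski1991, §3.1 Prop. 3.1.1 p. 455 L1–2] -/
theorem exists_deltaD_mulVec_eq (y : Fin (n + n) → Fp L) : ∃ a z : Fin n → Fp L,
    ((deltaD L : Matrix.symplecticGroup (Fin (n + n)) (Fp L)) :
        Matrix (Fin (n + n) ⊕ Fin (n + n)) (Fin (n + n) ⊕ Fin (n + n)) (Fp L)) *ᵥ
        Sum.elim (Sum.elim a a ∘ ⇑(e₂ (n := n)).symm) (gramD L e dV hdV dW hdW *ᵥ (Sum.elim z z ∘ ⇑(e₂ (n := n)).symm)) =
      Sum.elim (0 : Fin (n + n) → Fp L) y := by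
  refine ⟨-(y ∘ ⇑(e₂ (n := n)) ∘ Sum.inr), (gramR L e dV hdV dW hdW)⁻¹ *ᵥ (y ∘ ⇑(e₂ (n := n)) ∘ Sum.inl), ?_⟩
  rw [deltaD_mulVec_diag, Matrix.mulVec_mulVec, Matrix.mul_nonsing_inv _ (isUnit_det_gramR₀ L e dV hdV hdV0 dW hdW hdW0),
    Matrix.one_mulVec, neg_neg]
  congr 1
  funext j
  obtain ⟨k, rfl⟩ := (e₂ (n := n)).surjective j
  simp only [Function.comp_apply, Equiv.symm_apply_apply]
  rcases k with k | k <;> rfl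

/-- the Siegel block condition on the RATIONAL matrix `γ ∈ H(L⁺) ≤ GL_{n+n}(L)`.
[cite: GelbartRogawski1991, §3.1 Prop. 3.1.1 p. 455 L1–2] -/
def IsSiegelRat (γ : UnitaryGroup.rational (Fp L) L (IsCMField.complexConj L) (n + n) (hermD L e dV hdV dW hdW)) : Prop :=
  (Matrix.reindex (e₂ (n := n)).symm (e₂ (n := n)).symm
        ((γ : GL (Fin (n + n)) L) : Matrix (Fin (n + n)) (Fin (n + n)) L)).toBlocks₁₁ +
      (Matrix.reindex (e₂ (n := n)).symm (e₂ (n := n)).symm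
        ((γ : GL (Fin (n + n)) L) : Matrix (Fin (n + n)) (Fin (n + n)) L)).toBlocks₁₂ =
    (Matrix.reindex (e₂ (n := n)).symm (e₂ (n := n)).symm
        ((γ : GL (Fin (n + n)) L) : Matrix (Fin (n + n)) (Fin (n + n)) L)).toBlocks₂₁ +
      (Matrix.reindex (e₂ (n := n)).symm (e₂ (n := n)).symm
        ((γ : GL (Fin (n + n)) L) : Matrix (Fin (n + n)) (Fin (n + n)) L)).toBlocks₂₂

/-- `IsSiegelDelta (γ ⊗ 1) → IsSiegelRat γ` (injectivity of `L → 𝔸_L`).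
[cite: GelbartRogawski1991, §3.1 Prop. 3.1.1 p. 455 L1–2] -/
theorem isSiegelRat_of_isSiegelDelta
    (γ : UnitaryGroup.rational (Fp L) L (IsCMField.complexConj L) (n + n) (hermD L e dV hdV dW hdW))
    (hS : IsSiegelDelta L e dV hdV dW hdW
      (UnitaryGroup.toAdelic (Fp L) L (IsCMField.complexConj L) (n + n) (hermD L e dV hdV dW hdW) γ)) :
    IsSiegelRat L e dV hdV dW hdW γ := by
  refine Matrix.map_injective (AdeleRing.algebraMap_injective (𝓞 L) L) ?_
  beta_reduce
  rw [Matrix.map_add _ (map_add _), Matrix.map_add _ (map_add _)]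
  exact hS

/-- a Siegel `γ` maps diagonal vectors `(W, W)` to diagonal vectors.
[cite: GelbartRogawski1991, §3.1 Prop. 3.1.1 p. 455 L1–2] -/
theorem mulVec_diag_of_isSiegelRat
    (γ : UnitaryGroup.rational (Fp L) L (IsCMField.complexConj L) (n + n) (hermD L e dV hdV dW hdW))
    (hS : IsSiegelRat L e dV hdV dW hdW γ) (W : Fin n → L) :
    ((γ : GL (Fin (n + n)) L) : Matrix (Fin (n + n)) (Fin (n + n)) L) *ᵥ (Sum.elim W W ∘ ⇑(e₂ (n := n)).symm) =
      Sum.elim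
        (((Matrix.reindex (e₂ (n := n)).symm (e₂ (n := n)).symm
            ((γ : GL (Fin (n + n)) L) : Matrix (Fin (n + n)) (Fin (n + n)) L)).toBlocks₁₁ +
          (Matrix.reindex (e₂ (n := n)).symm (e₂ (n := n)).symm
            ((γ : GL (Fin (n + n)) L) : Matrix (Fin (n + n)) (Fin (n + n)) L)).toBlocks₁₂) *ᵥ W)
        (((Matrix.reindex (e₂ (n := n)).symm (e₂ (n := n)).symm
            ((γ : GL (Fin (n + n)) L) : Matrix (Fin (n + n)) (Fin (n + n)) L)).toBlocks₁₁ +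
          (Matrix.reindex (e₂ (n := n)).symm (e₂ (n := n)).symm
            ((γ : GL (Fin (n + n)) L) : Matrix (Fin (n + n)) (Fin (n + n)) L)).toBlocks₁₂) *ᵥ W) ∘
        ⇑(e₂ (n := n)).symm := by
  rw [mulVec_comp_equiv_symm']
  set G := Matrix.reindex (e₂ (n := n)).symm (e₂ (n := n)).symm
    ((γ : GL (Fin (n + n)) L) : Matrix (Fin (n + n)) (Fin (n + n)) L) with hG
  have h1 : G *ᵥ Sum.elim W W = Sum.elim ((G.toBlocks₁₁ + G.toBlocks₁₂) *ᵥ W) ((G.toBlocks₂₁ + G.toBlocks₂₂) *ᵥ W) := by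
    conv_lhs => rw [← Matrix.fromBlocks_toBlocks G]
    rw [Matrix.fromBlocks_mulVec, Sum.elim_comp_inl, Sum.elim_comp_inr, Matrix.add_mulVec, Matrix.add_mulVec]
  rw [h1]
  change _ = _ at hS
  rw [← hS]

omit [NumberField L] [IsCMField L] in
/-- pointwise `reIm` of a diagonal vector is a pair of diagonal vectors.
[cite: GelbartRogawski1991, §3.1 Prop. 3.1.1 p. 455 L1–2] -/
theorem reIm_diag (Ψ : (Fp L × Fp L) ≃+ L) (W : Fin n → L) :
    UnitaryGroup.QuadraticCoordinates.reIm Ψ (Fin (n + n)) (Sum.elim W W ∘ ⇑(e₂ (n := n)).symm) =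
      (Sum.elim (fun i => UnitaryGroup.QuadraticCoordinates.re Ψ (W i))
          (fun i => UnitaryGroup.QuadraticCoordinates.re Ψ (W i)) ∘ ⇑(e₂ (n := n)).symm,
        Sum.elim (fun i => UnitaryGroup.QuadraticCoordinates.im Ψ (W i))
          (fun i => UnitaryGroup.QuadraticCoordinates.im Ψ (W i)) ∘ ⇑(e₂ (n := n)).symm) := by
  refine Prod.ext (funext fun j => ?_) (funext fun j => ?_)
  · rw [UnitaryGroup.QuadraticCoordinates.reIm_apply_fst]
    simp only [Function.comp_apply]
    generalize (e₂ (n := n)).symm j = k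
    rcases k with k | k <;> rfl
  · rw [UnitaryGroup.QuadraticCoordinates.reIm_apply_snd]
    simp only [Function.comp_apply]
    generalize (e₂ (n := n)).symm j = k
    rcases k with k | k <;> rfl

omit [NumberField L] [IsCMField L] in
/-- the inverse direction: `reIm⁻¹` of a pair of diagonal vectors is diagonal.
[cite: GelbartRogawski1991, §3.1 Prop. 3.1.1 p. 455 L1–2] -/
theorem reIm_symm_diag (Ψ : (Fp L × Fp L) ≃+ L) (a z : Fin n → Fp L) :
    (UnitaryGroup.QuadraticCoordinates.reIm Ψ (Fin (n + n))).symm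
        (Sum.elim a a ∘ ⇑(e₂ (n := n)).symm, Sum.elim z z ∘ ⇑(e₂ (n := n)).symm) =
      Sum.elim (fun i => Ψ (a i, z i)) (fun i => Ψ (a i, z i)) ∘ ⇑(e₂ (n := n)).symm := by
  funext j
  rw [UnitaryGroup.QuadraticCoordinates.reIm_symm_apply]
  simp only [Function.comp_apply]
  generalize (e₂ (n := n)).symm j = k
  rcases k with k | k <;> rfl

/-- **the rational restriction-of-scalars matrix of `γ ∈ H(L⁺)`** in Mathlib's symplectic coordinates of `𝕎^𝔻`
(`untransportSp T^𝔻 ∘ rationalToSymplectic`). [cite: GelbartRogawski1991, §3.1 Prop. 3.1.1 p. 455 L1–2] -/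
def resSpD (γ : UnitaryGroup.rational (Fp L) L (IsCMField.complexConj L) (n + n) (hermD L e dV hdV dW hdW)) :
    Matrix.symplecticGroup (Fin (n + n)) (Fp L) :=
  UnitaryGroup.SpTransport.untransportSp (gramD L e dV hdV dW hdW) (isUnit_det_gramD L e dV hdV hdV0 dW hdW hdW0)
    (UnitaryGroup.rationalToSymplectic (Fp L) L (IsCMField.complexConj L) (n + n) (complexConj_imagUnit L)
      (imagUnit_ne_zero L) (imagUnit_mul_self L) (gramD_isSymm L e dV hdV dW hdW) rfl γ)

include hdV0 hdW0 in
/-- `ratSp (resSpD γ) = ι^𝔻 (γ ⊗ 1)` (tree `adelicToSymplectic_toAdelic_eq_transportSp`).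
[cite: GelbartRogawski1991, §3.1 Prop. 3.1.1 p. 455 L1–2] -/
theorem ratSp_resSpD (γ : UnitaryGroup.rational (Fp L) L (IsCMField.complexConj L) (n + n) (hermD L e dV hdV dW hdW)) :
    ratSp (Fp L) (gramDA L e dV hdV dW hdW) (isUnit_det_gramDA L e dV hdV hdV0 dW hdW hdW0)
        (resSpD L e dV hdV hdV0 dW hdW hdW0 γ) =
      toSpD L e dV hdV dW hdW
        (UnitaryGroup.toAdelic (Fp L) L (IsCMField.complexConj L) (n + n) (hermD L e dV hdV dW hdW) γ) :=
  (UnitaryGroup.adelicToSymplectic_toAdelic_eq_transportSp (Fp L) L (IsCMField.complexConj L) (n + n)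
    (complexConj_imagUnit L) (imagUnit_ne_zero L) (imagUnit_mul_self L) (gramD_isSymm L e dV hdV dW hdW)
    (isUnit_det_gramD L e dV hdV hdV0 dW hdW hdW0) (isUnit_det_gramDA L e dV hdV hdV0 dW hdW hdW0) rfl γ).symm

include hdV0 hdW0 in
/-- a Siegel `γ` preserves the Darboux image of the diagonal: `resSpD γ` maps `P(a,a; z,z)` to a vector of the same shape.
[cite: GelbartRogawski1991, §3.1 Prop. 3.1.1 p. 455 L1–2] -/
theorem resSpD_mulVec_diag
    (γ : UnitaryGroup.rational (Fp L) L (IsCMField.complexConj L) (n + n) (hermD L e dV hdV dW hdW))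
    (hS : IsSiegelRat L e dV hdV dW hdW γ) (a z : Fin n → Fp L) : ∃ a' z' : Fin n → Fp L,
    ((resSpD L e dV hdV hdV0 dW hdW hdW0 γ : Matrix.symplecticGroup (Fin (n + n)) (Fp L)) :
        Matrix (Fin (n + n) ⊕ Fin (n + n)) (Fin (n + n) ⊕ Fin (n + n)) (Fp L)) *ᵥ
        Sum.elim (Sum.elim a a ∘ ⇑(e₂ (n := n)).symm) (gramD L e dV hdV dW hdW *ᵥ (Sum.elim z z ∘ ⇑(e₂ (n := n)).symm)) =
      Sum.elim (Sum.elim a' a' ∘ ⇑(e₂ (n := n)).symm)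
        (gramD L e dV hdV dW hdW *ᵥ (Sum.elim z' z' ∘ ⇑(e₂ (n := n)).symm)) := by
  obtain ⟨Ψ, hΨ⟩ : ∃ Ψ : (Fp L × Fp L) ≃+ L, ∀ x : Fin (n + n) → L,
      (UnitaryGroup.rationalToSymplectic (Fp L) L (IsCMField.complexConj L) (n + n) (complexConj_imagUnit L)
          (imagUnit_ne_zero L) (imagUnit_mul_self L) (gramD_isSymm L e dV hdV dW hdW) rfl γ).1
          (UnitaryGroup.QuadraticCoordinates.reIm Ψ (Fin (n + n)) x) =
        UnitaryGroup.QuadraticCoordinates.reIm Ψ (Fin (n + n))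
          (((γ : GL (Fin (n + n)) L) : Matrix (Fin (n + n)) (Fin (n + n)) L) *ᵥ x) :=
    ⟨_, UnitaryGroup.rationalToSymplectic_reIm (Fp L) L (IsCMField.complexConj L) (n + n) (complexConj_imagUnit L)
      (imagUnit_ne_zero L) (imagUnit_mul_self L) (gramD_isSymm L e dV hdV dW hdW) rfl γ⟩
  set W : Fin n → L := fun i => Ψ (a i, z i) with hW
  have h1 : (Sum.elim a a ∘ ⇑(e₂ (n := n)).symm, Sum.elim z z ∘ ⇑(e₂ (n := n)).symm) =
      UnitaryGroup.QuadraticCoordinates.reIm Ψ (Fin (n + n)) (Sum.elim W W ∘ ⇑(e₂ (n := n)).symm) := by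
    rw [← reIm_symm_diag L Ψ a z, AddEquiv.apply_symm_apply]
  obtain ⟨W', hW'⟩ : ∃ W' : Fin n → L,
      ((γ : GL (Fin (n + n)) L) : Matrix (Fin (n + n)) (Fin (n + n)) L) *ᵥ (Sum.elim W W ∘ ⇑(e₂ (n := n)).symm) =
        Sum.elim W' W' ∘ ⇑(e₂ (n := n)).symm :=
    ⟨_, mulVec_diag_of_isSiegelRat L e dV hdV dW hdW γ hS W⟩
  have h2 := hΨ (Sum.elim W W ∘ ⇑(e₂ (n := n)).symm)
  rw [← h1, hW', reIm_diag] at h2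
  refine ⟨fun i => UnitaryGroup.QuadraticCoordinates.re Ψ (W' i), fun i => UnitaryGroup.QuadraticCoordinates.im Ψ (W' i), ?_⟩
  rw [resSpD, UnitaryGroup.SpTransport.coe_untransportSp]
  have hd : Sum.elim (Sum.elim a a ∘ ⇑(e₂ (n := n)).symm)
      (gramD L e dV hdV dW hdW *ᵥ (Sum.elim z z ∘ ⇑(e₂ (n := n)).symm)) =
      SymplecticMatrix.darboux (gramD L e dV hdV dW hdW) (isUnit_det_gramD L e dV hdV hdV0 dW hdW hdW0)
        (Sum.elim a a ∘ ⇑(e₂ (n := n)).symm, Sum.elim z z ∘ ⇑(e₂ (n := n)).symm) := rfl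
  rw [hd, UnitaryGroup.SpTransport.untransportMatrix_mulVec, LinearEquiv.symm_apply_apply]
  change SymplecticMatrix.darboux _ _ ((UnitaryGroup.rationalToSymplectic (Fp L) L (IsCMField.complexConj L) (n + n)
    (complexConj_imagUnit L) (imagUnit_ne_zero L) (imagUnit_mul_self L) (gramD_isSymm L e dV hdV dW hdW) rfl γ).1
    (Sum.elim a a ∘ ⇑(e₂ (n := n)).symm, Sum.elim z z ∘ ⇑(e₂ (n := n)).symm)) = _
  rw [h2]
  rfl

include hdV0 hdW0 in
/-- **S3-dec (RATIONAL SIEGEL DECOMPOSITION)**: for a rational Siegel `p = γ ⊗ 1`, `B := resSpD γ` satisfies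
`ratSp B = ι^𝔻 p` and `δ B δ⁻¹` is block-lower-triangular (it preserves `𝕐 = δ(P Δ)`), hence `= v(σ) m(a)`.
[cite: GelbartRogawski1991, §3.1 Prop. 3.1.1 p. 455 L1–2] -/
theorem S3dec_siegel_decomposition (p : HA L e dV hdV dW hdW) (hp : p ∈ ratH L e dV hdV dW hdW)
    (hS : IsSiegelDelta L e dV hdV dW hdW p) :
    ∃ B : Matrix.symplecticGroup (Fin (n + n)) (Fp L),
      ratSp (Fp L) (gramDA L e dV hdV dW hdW) (isUnit_det_gramDA L e dV hdV hdV0 dW hdW hdW0) B = toSpD L e dV hdV dW hdW p ∧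
      deltaD L * B * (deltaD L)⁻¹ ∈ Submonoid.closure ((Set.range (SymplecticMatrix.levi (l := Fin (n + n)) (R := Fp L))) ∪
        {x | ∃ σ hσ, x = SymplecticMatrix.low (l := Fin (n + n)) (R := Fp L) σ hσ}) := by
  obtain ⟨γ, rfl⟩ := hp
  have hS' := isSiegelRat_of_isSiegelDelta L e dV hdV dW hdW γ hS
  refine ⟨resSpD L e dV hdV hdV0 dW hdW hdW0 γ, ratSp_resSpD L e dV hdV hdV0 dW hdW hdW0 γ, ?_⟩
  apply mem_closure_levi_low_of_toBlocks₁₂_eq_zero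
  apply toBlocks₁₂_eq_zero_of_mulVec
  intro y
  obtain ⟨a, z, hy⟩ := exists_deltaD_mulVec_eq L e dV hdV hdV0 dW hdW hdW0 y
  obtain ⟨a', z', hB⟩ := resSpD_mulVec_diag L e dV hdV hdV0 dW hdW hdW0 γ hS' a z
  refine ⟨Sum.elim (gramR L e dV hdV dW hdW *ᵥ z') (-a') ∘ ⇑(e₂ (n := n)).symm, ?_⟩
  have hinv : (((deltaD L)⁻¹ : Matrix.symplecticGroup (Fin (n + n)) (Fp L)) :
      Matrix (Fin (n + n) ⊕ Fin (n + n)) (Fin (n + n) ⊕ Fin (n + n)) (Fp L)) *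
      ((deltaD L : Matrix.symplecticGroup (Fin (n + n)) (Fp L)) : Matrix _ _ (Fp L)) = 1 := by
    rw [← Submonoid.coe_mul, inv_mul_cancel]; rfl
  have hδu : (((deltaD L)⁻¹ : Matrix.symplecticGroup (Fin (n + n)) (Fp L)) :
      Matrix (Fin (n + n) ⊕ Fin (n + n)) (Fin (n + n) ⊕ Fin (n + n)) (Fp L)) *ᵥ
      (((deltaD L : Matrix.symplecticGroup (Fin (n + n)) (Fp L)) : Matrix _ _ (Fp L)) *ᵥ
        Sum.elim (Sum.elim a a ∘ ⇑(e₂ (n := n)).symm)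
          (gramD L e dV hdV dW hdW *ᵥ (Sum.elim z z ∘ ⇑(e₂ (n := n)).symm))) =
      Sum.elim (Sum.elim a a ∘ ⇑(e₂ (n := n)).symm)
        (gramD L e dV hdV dW hdW *ᵥ (Sum.elim z z ∘ ⇑(e₂ (n := n)).symm)) := by
    rw [Matrix.mulVec_mulVec, hinv, Matrix.one_mulVec]
  rw [Submonoid.coe_mul, Submonoid.coe_mul, ← Matrix.mulVec_mulVec, ← Matrix.mulVec_mulVec, ← hy, hδu, hB,
    deltaD_mulVec_diag]

/-! #### S3: the rational parabolic clause, assembled -/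

omit [IsCMField L] in
/-- **S3-ne**: `𝒮(𝔸^{n+n})` has a function with `Φ(0) ≠ 0` — `φ₀ ⊗ 𝟙_{𝒪̂^{n+n}}` (`unitSchwartz ⊗ indicatorSB`,
`coe_piSchwartzBruhatEquiv_tmul`, `unitSchwartz_apply_zero`).
[cite: GelbartRogawski1991, §3.1 Prop. 3.1.1 p. 455 L1–2] -/
theorem exists_piSchwartzBruhat_apply_zero_ne_zero :
    ∃ Φ : piSchwartzBruhat (Fp L) (Fin (n + n)), (Φ : (Fin (n + n) → AdeleRing (𝓞 (Fp L)) (Fp L)) → ℂ) 0 ≠ 0 := by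
  refine ⟨piSchwartzBruhatEquiv (Fp L) (Fin (n + n)) (unitSchwartz (Fp L) (Fin (n + n)) ⊗ₜ[ℂ]
    indicatorSB (Fp L) (Fin (n + n)) (piLevelIdeal (Fp L) (Fin (n + n)) ⊤) (isOpen_piLevelIdeal (Fp L) ⊤)
      (isCompact_piLevelIdeal (Fp L) (Fin (n + n)) ⊤)), ?_⟩
  rw [coe_piSchwartzBruhatEquiv_tmul]
  have h0 : piArch (Fp L) (Fin (n + n)) 0 = 0 := by
    funext i
    rw [piArch_apply, Pi.zero_apply]
    exact map_zero (InfiniteAdeleRing.ringEquiv_mixedSpace (Fp L))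
  have h1 : piFinite (Fp L) (Fin (n + n)) 0 = 0 := rfl
  simp only [h0, h1, unitSchwartz_apply_zero, one_mul, coe_indicatorSB]
  rw [Set.indicator_of_mem (show (0 : Fin (n + n) → FiniteAdeleRing (𝓞 (Fp L)) (Fp L)) ∈
    (piLevelIdeal (Fp L) (Fin (n + n)) ⊤ : Set _) from (piLevelIdeal (Fp L) (Fin (n + n)) ⊤).zero_mem)]
  exact one_ne_zero

/-- ABSTRACT core of S3: in a group `M` with a functional-type predicate pinned by conjugation, if `y` (the candidate) and `x`
(the value) have the same image under `π`, and their `d`-conjugates take the same "value" `v`, non-vanishing, they are equal —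
packaged so that the concrete instantiation is ONE term. [cite: GelbartRogawski1991, §3.1 Prop. 3.1.1 p. 455 L1–2] -/
theorem S3_abstract {M Sp : Type*} [Group M] [Group Sp] (π : M →* Sp) (V : Type*) (ev : M → V → ℂ)
    (pin : ∀ x y : M, π x = π y → (∀ f, ev x f = ev y f) → (∃ f, ev x f ≠ 0) → x = y)
    (d x y : M) (hπ : π x = π y) (hx : ∀ f, ev (d * x * d⁻¹) f = ev (d * y * d⁻¹) f)
    (hne : ∃ f, ev (d * x * d⁻¹) f ≠ 0) : x = y := by
  have h := pin (d * x * d⁻¹) (d * y * d⁻¹) (by rw [map_mul, map_mul, map_mul, map_mul, hπ]) hx hne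
  simpa [mul_assoc] using congrArg (fun z => d⁻¹ * z * d) h

include hdV0 hdW0 in
set_option maxHeartbeats 1600000 in
set_option synthInstance.maxHeartbeats 400000 in
/-- **S3 (RATIONAL PARABOLIC CLAUSE)** from S3-dec
and S3-unit, S3-ne, S3b-val, S3c and the pinning lemma: on `P_Δ(L⁺)` the prescribed values ARE Weil's rational section,
`sD p ∈ range r_F^𝔻`.  From S3-dec get `B` with `ι^𝔻 p = ratSp B` and `δ B δ⁻¹` in the Levi∕unipotent submonoid; then
`r_δ · r_F^𝔻(B) · r_δ⁻¹ = r_F^𝔻(δ B δ⁻¹)` fixes values at `0` (S3b-val), `sD p`'s `δ`-conjugate multiplies them by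
`χ(det_Δ p)|det_Δ p|^{1/2} = 1` (prescription + S3c), both lie over the same point of `Sp(𝔸)` — so they are equal (`S3_abstract` +
`eq_of_proj_eq_of_evalZero_eq` + S3-ne). [cite: GelbartRogawski1991, §3.1 Prop. 3.1.1 p. 455 L1–2] -/
theorem S3_parabolic_rational (χ : HeckeCharacter L) {sD : HA L e dV hdV dW hdW →* MpD L e dV hdV dW hdW}
    (hs : IsDoubledWeilRep L e dV hdV hdV0 dW hdW hdW0 χ sD) :
    ∀ p ∈ ratH L e dV hdV dW hdW, IsSiegelDelta L e dV hdV dW hdW p → sD p ∈ (rFD L e dV hdV hdV0 dW hdW hdW0).range := by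
  intro p hp hS
  have hu := isUnit_detDelta_of_isSiegelDelta L e dV hdV dW hdW p hS
  have hone := chiDet_mul_modDelta_eq_one_of_rational L e dV hdV dW hdW χ p hp hu
  have hpar := hs.parabolic p hS hu
  have hpe := hs.proj_eq p
  refine (S3dec_siegel_decomposition L e dV hdV hdV0 dW hdW hdW0 p hp hS).elim fun B hB => ⟨B, ?_⟩
  have h3 : rFD L e dV hdV hdV0 dW hdW hdW0 (deltaD L * B * (deltaD L)⁻¹) =
      rDelta L e dV hdV hdV0 dW hdW hdW0 * rFD L e dV hdV hdV0 dW hdW hdW0 B * (rDelta L e dV hdV hdV0 dW hdW hdW0)⁻¹ :=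
    ((rFD L e dV hdV hdV0 dW hdW hdW0).map_mul (deltaD L * B) (deltaD L)⁻¹).trans
      (congr (congrArg (· * ·) ((rFD L e dV hdV hdV0 dW hdW hdW0).map_mul (deltaD L) B))
        ((rFD L e dV hdV hdV0 dW hdW hdW0).map_inv (deltaD L)))
  have hmem : rDelta L e dV hdV hdV0 dW hdW hdW0 * rFD L e dV hdV hdV0 dW hdW hdW0 B *
      (rDelta L e dV hdV hdV0 dW hdW hdW0)⁻¹ ∈ evalZeroFixing L e dV hdV dW hdW := by
    have h := rFD_mem_evalZeroFixing_of_mem_closure L e dV hdV hdV0 dW hdW hdW0 hB.2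
    rw [h3] at h
    exact h
  have hval : ∀ Φ : piSchwartzBruhat (Fp L) (Fin (n + n)),
      opD L e dV hdV dW hdW (rDelta L e dV hdV hdV0 dW hdW hdW0 * rFD L e dV hdV hdV0 dW hdW hdW0 B *
          (rDelta L e dV hdV hdV0 dW hdW hdW0)⁻¹) Φ 0 =
        (Φ : (Fin (n + n) → AdeleRing (𝓞 (Fp L)) (Fp L)) → ℂ) 0 := hmem
  have hπ : projD L e dV hdV dW hdW (rFD L e dV hdV hdV0 dW hdW hdW0 B) = projD L e dV hdV dW hdW (sD p) :=
    (proj_ratThetaLiftCont (Fp L) (gramDA L e dV hdV dW hdW) (isUnit_det_gramDA L e dV hdV hdV0 dW hdW hdW0) B).trans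
      (hB.1.trans (hpe).symm)
  exact S3_abstract (projD L e dV hdV dW hdW) (piSchwartzBruhat (Fp L) (Fin (n + n)))
    (fun q Φ => opD L e dV hdV dW hdW q Φ 0) (eq_of_proj_eq_of_evalZero_eq L e dV hdV hdV0 dW hdW hdW0)
    (rDelta L e dV hdV hdV0 dW hdW hdW0) _ _ hπ
    (fun Φ => (hval Φ).trans (((one_mul _).symm.trans (congrArg (· * _) hone.symm)).trans (hpar Φ).symm))
    ((exists_piSchwartzBruhat_apply_zero_ne_zero L).elim fun Φ hΦ => ⟨Φ, fun h0 => hΦ ((hval Φ).symm.trans h0)⟩)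

/-- ABSTRACT GROUP THEORY behind S3′: with `π : M → S`, a section-like `s : G → M` over `ι`, a "rational section"
`r : R → M` over `ρ`, `ker π` central, `ι(Γ) ⊆ ρ(R)`: if `s` is `r`-valued on `P ∩ Γ` then it is `r`-valued on the closure of
the `Γ`-conjugates of `P ∩ Γ`. [cite: GelbartRogawski1991, §3.1 Prop. 3.1.1 p. 455 L1–2] -/
theorem propagate_abstract {G M S R : Type*} [Group G] [Group M] [Group S] [Group R]
    (π : M →* S) (ι : G →* S) (s : G →* M) (r : R →* M) (ρ : R →* S)
    (hr : ∀ B, π (r B) = ρ B) (hs : ∀ g, π (s g) = ι g)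
    (hcen : ∀ z : M, π z = 1 → z ∈ Subgroup.center M) (Γ : Subgroup G) (hΓ : ∀ h ∈ Γ, ι h ∈ ρ.range)
    (P : Set G) (hP : ∀ p ∈ Γ, p ∈ P → s p ∈ r.range)
    (hgen : ∀ γ ∈ Γ, γ ∈ Subgroup.closure {x : G | ∃ p ∈ Γ, ∃ h ∈ Γ, p ∈ P ∧ x = h * p * h⁻¹}) :
    ∀ γ ∈ Γ, s γ ∈ r.range := by
  intro γ hγ
  have hle : Subgroup.closure {x : G | ∃ p ∈ Γ, ∃ h ∈ Γ, p ∈ P ∧ x = h * p * h⁻¹} ≤ (r.range).comap s := by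
    rw [Subgroup.closure_le]
    rintro x ⟨p, hp, h, hh, hpS, rfl⟩
    obtain ⟨A, hA⟩ := hP p hp hpS
    obtain ⟨B, hB⟩ := hΓ h hh
    -- `s h = z · r B` with `z` central
    set z := s h * (r B)⁻¹ with hz
    have hzc : z ∈ Subgroup.center M := hcen z (by rw [hz, map_mul, map_inv, hs, hr, hB, mul_inv_cancel])
    have hzc' := Subgroup.mem_center_iff.1 hzc
    have hsh : s h = z * r B := by rw [hz, inv_mul_cancel_right]
    rw [SetLike.mem_coe, Subgroup.mem_comap, MonoidHom.mem_range]
    refine ⟨B * A * B⁻¹, ?_⟩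
    rw [map_mul, map_mul, map_inv, map_mul, map_mul, map_inv, hsh, ← hA, mul_inv_rev]
    calc r B * r A * (r B)⁻¹ = z * (r B * r A * (r B)⁻¹) * z⁻¹ := by
          rw [← hzc' (r B * r A * (r B)⁻¹), mul_inv_cancel_right]
      _ = z * r B * r A * ((r B)⁻¹ * z⁻¹) := by simp only [mul_assoc]
  exact Subgroup.mem_comap.1 (hle (hgen γ hγ))

/-- **S3′ (CENTRAL-CHARACTER PROPAGATION)** (from S3a, S3b via `propagate_abstract`): `sD` and `r_F^𝔻 ∘ ι^𝔻` agree on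
the subgroup generated by the `H(L⁺)`-conjugates of the elements of `P_Δ(L⁺)` where they agree.
[cite: GelbartRogawski1991, §3.1 Prop. 3.1.1 p. 455 L1–2] -/
theorem S3'_propagate (χ : HeckeCharacter L) {sD : HA L e dV hdV dW hdW →* MpD L e dV hdV dW hdW}
    (hs : IsDoubledWeilRep L e dV hdV hdV0 dW hdW hdW0 χ sD)
    (hP : ∀ p ∈ ratH L e dV hdV dW hdW, IsSiegelDelta L e dV hdV dW hdW p → sD p ∈ (rFD L e dV hdV hdV0 dW hdW hdW0).range)
    (hgen : ∀ γ ∈ ratH L e dV hdV dW hdW, γ ∈ Subgroup.closure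
      {x : HA L e dV hdV dW hdW | ∃ p ∈ ratH L e dV hdV dW hdW, ∃ h ∈ ratH L e dV hdV dW hdW,
        IsSiegelDelta L e dV hdV dW hdW p ∧ x = h * p * h⁻¹}) :
    ∀ γ ∈ ratH L e dV hdV dW hdW, sD γ ∈ (rFD L e dV hdV hdV0 dW hdW hdW0).range :=
  propagate_abstract (projD L e dV hdV dW hdW) (toSpD L e dV hdV dW hdW) sD (rFD L e dV hdV hdV0 dW hdW hdW0)
    (ratSp (Fp L) (gramDA L e dV hdV dW hdW) (isUnit_det_gramDA L e dV hdV hdV0 dW hdW hdW0))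
    (proj_ratThetaLiftCont (Fp L) (gramDA L e dV hdV dW hdW) (isUnit_det_gramDA L e dV hdV hdV0 dW hdW hdW0))
    hs.proj_eq (S3a_central_of_proj_eq_one L e dV hdV hdV0 dW hdW hdW0) (ratH L e dV hdV dW hdW)
    (toSpD_mem_range_ratSp L e dV hdV hdV0 dW hdW hdW0) {p | IsSiegelDelta L e dV hdV dW hdW p} hP hgen


/-! ### Build-lane note (ops-buildfix G11b-3 recipe, LEDGER B13-1, 2026-08-21)
`lean -o` (the hub build lane, never `lean`/the gate check) runs Lean 4.32's library-suggestion indexers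
(`Lean.LibrarySuggestions.SymbolFrequency` / `SineQuaNon`, from their `exportEntriesFn`) over the statement of
every local theorem that is not a denied premise; on this family's statements (very large dependent binder
telescopes through the theta-kernel / dual-pair data) that fold runs for tens of minutes to hours and the build
lane kills the job (incident G11b-3, run/shared/lean/ops/buildfix/G11b-3-DOSSIER.md). `isDeniedPremise` skips
`[implicit_reducible]` constants before any fold, and a reducibility status on a *theorem* is inert (Meta never
unfolds `thmInfo`; the kernel ignores the attribute), so the public theorems of this file are tagged
`[implicit_reducible]` purely to keep them out of that index. Only other effect: they are not offered by
`+suggestions` premise selectors. No statement or proof is changed; superseded if the operator lands a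
deny-list form (`HarnessLib.PremiseIndex`). -/
set_option allowUnsafeReducibility true in
attribute [implicit_reducible]
  mem_closure_levi_low_of_toBlocks₁₂_eq_zero toBlocks₁₂_eq_zero_of_mulVec gramD_mulVec_diag
  deltaD_mulVec_diag exists_deltaD_mulVec_eq isSiegelRat_of_isSiegelDelta
  mulVec_diag_of_isSiegelRat reIm_diag reIm_symm_diag ratSp_resSpD resSpD_mulVec_diag
  S3dec_siegel_decomposition exists_piSchwartzBruhat_apply_zero_ne_zero S3_abstract
  S3_parabolic_rational propagate_abstract S3'_propagate

end Literature.NumberTheory.GelbartRogawski1991.GRConstruction
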